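import Mathlib
import Summits.ValiantsHypothesis.ValiantsHypothesis.Theorems.NewtonUnitEquationsDissociatedUniformTotalsLawConvexPosition
import HarnessLib

/-!
# Crux `NewtonUnitEquations.DissociatedUniform` (stmt-ValiantsHypothesis-5905): the CONE SWEEP — how many vertices of a strictly
# convex fibre can share a weak-top direction with ONE vertex of a strictly convex third polygon

Memo `Cruxes/DissociatedUniform/NOTES-t1g8.md` §2/§5(i).  In the dominant-third-curve regime the pointwise question "is `V_s = O(q)`?" is,
by `…TotalsLawLargeThirdPointwise.classVert_smul_le_card_commonDir`, the count of pairs `(z, x)` such that the letter `c z` of `C` and the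
fibre point `x` of `P_{s−z}` are weak tops for one and the same non-zero weight.  This file proves the LOCAL half of the positive answer
(NOTES-t1g8 §5(i), "`V_s = q + Σ_z #(E_{s−z} ∩ K_z)`"): for a fixed vertex `z` of a strictly convex counter-clockwise polygon `c` and ANY
curve `P` whose weak tops are SHARP (at most two per non-zero weight, and then label-adjacent — e.g. every strictly convex polygon),

`#{x : ∃ θ ≠ 0, c z and P x weak tops at θ} ≤ 1 + #{x : ∃ θ ≠ 0, c z, P x, P (x+1) weak tops at θ}` — the count itself is
`card_commonTop_le` in the companion `…TotalsLawConeCount`; this file holds its two ingredients: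

* the NORMAL CONE of a vertex of a strictly convex ccw polygon: `wTop_iff_local` (weak top ⟺ `⟨θ,Δ(z−1)⟩ ≥ 0 ≥ ⟨θ,Δ z⟩`), the cone path
  `conePath c z t = (1−t)·perp Δ(z−1) + t·perp Δ z`, `wTop_conePath`, `exists_conePath_of_wTop` (every non-zero weak-top weight of `c z` is
  a positive multiple of a path point, `t ∈ [0,1]`), and `sharpTops_of_strictlyConvexCcw` (at most two weak tops per non-zero weight,
  label-adjacent: `SharpTops`);
* an abstract SWEEP LEMMA on `[0,1]` (`exists_min_mem_other`, `not_mutual_min`): for finitely many closed sets covering `[0,1]` at most two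
  deep, an index absent at `t = 0` first appears at a time shared with another index, and two indices cannot first appear through each
  other.
Honest label: lemmas (all strictly convex ccw `c`, all curves `P`); the local input of the rigid-pair pointwise law (`…TotalsLawRigidPairs`);
`CoOrientedClassBound`, `SmoothSharpTotalsLaw`, `TotalsLawThree` remain OPEN; nothing here bears on VP ≠ VNP.
[folklore: normal cones of a convex polygon; a finite closed cover of an interval]
-/

set_option linter.dupNamespace false -- `ValiantsHypothesis.ValiantsHypothesis` (summit = problem) in every name

open scoped BigOperators

namespace Summit.ValiantsHypothesis.ValiantsHypothesis.Theorems.NewtonUnitEquationsDissociatedUniform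

namespace TotalsLaw

open Matrix Set

/-! ### The abstract sweep lemma on `[0,1]` -/

section Sweep

variable {ι : Type*} [Fintype ι] [DecidableEq ι]

/-- If the closed sets `T y`, `y ∉ E`, cover `[0, t)` (`t > 0`), one of them contains `t`. [folklore] -/
theorem exists_mem_of_Ico_covered (T : ι → Set ℝ) (hT : ∀ x, IsClosed (T x)) (E : Finset ι) {t : ℝ} (ht : 0 < t)
    (h : ∀ s : ℝ, 0 ≤ s → s < t → ∃ y, y ∉ E ∧ s ∈ T y) : ∃ y, y ∉ E ∧ t ∈ T y := by
  set U : Set ℝ := ⋃ y ∈ ((Finset.univ \ E : Finset ι) : Set ι), T y with hU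
  have hUc : IsClosed U := (Finset.univ \ E).finite_toSet.isClosed_biUnion fun y _ => hT y
  have hsub : Ico (0 : ℝ) t ⊆ U := by
    intro s hs
    obtain ⟨y, hyE, hsy⟩ := h s hs.1 hs.2
    rw [hU]
    exact Set.mem_biUnion (show y ∈ ((Finset.univ \ E : Finset ι) : Set ι) by simp [hyE]) hsy
  have htU : t ∈ U := by
    have h1 : t ∈ closure (Ico (0 : ℝ) t) := by
      rw [closure_Ico ht.ne]; exact ⟨ht.le, le_rfl⟩
    exact (hUc.closure_subset_iff.2 hsub) h1
  rw [hU] at htU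
  obtain ⟨y, hy, hty⟩ := Set.mem_iUnion₂.1 htU
  exact ⟨y, by simpa using hy, hty⟩

/-- **Sweep lemma, entry times.**  Let closed sets `T x` cover `[0,1]`.  If `x` occurs in `[0,1]` but not at `0`, then its FIRST time
`t ∈ (0,1]` is shared with another index `y ≠ x`. [folklore] -/
theorem exists_min_mem_other (T : ι → Set ℝ) (hT : ∀ x, IsClosed (T x)) (hcov : ∀ s ∈ Icc (0 : ℝ) 1, ∃ x, s ∈ T x)
    {x : ι} {t₀ : ℝ} (ht₀ : t₀ ∈ Icc (0 : ℝ) 1) (hx : t₀ ∈ T x) (h0 : (0 : ℝ) ∉ T x) :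
    ∃ t ∈ Icc (0 : ℝ) 1, t ∈ T x ∧ 0 < t ∧ (∀ s ∈ Icc (0 : ℝ) 1, s ∈ T x → t ≤ s) ∧ ∃ y, y ≠ x ∧ t ∈ T y := by
  set S : Set ℝ := T x ∩ Icc 0 1 with hS
  have hSc : IsClosed S := (hT x).inter isClosed_Icc
  have hSne : S.Nonempty := ⟨t₀, hx, ht₀⟩
  have hSbdd : BddBelow S := ⟨0, fun s hs => hs.2.1⟩
  set t := sInf S with ht
  have htS : t ∈ S := hSc.csInf_mem hSne hSbdd
  have hmin : ∀ s ∈ Icc (0 : ℝ) 1, s ∈ T x → t ≤ s := fun s hs hsx => csInf_le hSbdd ⟨hsx, hs⟩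
  have htpos : 0 < t := by
    rcases lt_or_eq_of_le htS.2.1 with h | h
    · exact h
    · exact absurd (h ▸ htS.1) h0
  obtain ⟨y, hy, hty⟩ := exists_mem_of_Ico_covered T hT {x} htpos fun s hs0 hst => by
    have hs1 : s ∈ Icc (0 : ℝ) 1 := ⟨hs0, (hst.le.trans htS.2.2)⟩
    obtain ⟨y, hsy⟩ := hcov s hs1
    refine ⟨y, fun hyx => ?_, hsy⟩
    rw [Finset.mem_singleton] at hyx
    subst hyx
    exact absurd (hmin s hs1 hsy) (not_le.2 hst)
  exact ⟨t, htS.2, htS.1, htpos, hmin, y, by simpa using hy, hty⟩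

/-- **Sweep lemma, no mutual entries.**  If moreover no time in `[0,1]` lies in three of the sets, two indices absent at `0` cannot
enter through each other (their common first time would need a third index present just before). [folklore] -/
theorem not_mutual_min (T : ι → Set ℝ) (hT : ∀ x, IsClosed (T x)) (hcov : ∀ s ∈ Icc (0 : ℝ) 1, ∃ x, s ∈ T x)
    (h2 : ∀ s ∈ Icc (0 : ℝ) 1, ∀ x y w : ι, s ∈ T x → s ∈ T y → s ∈ T w → x = y ∨ y = w ∨ x = w)
    {x x' : ι} (hxx' : x ≠ x') {t t' : ℝ}
    (ht : t ∈ Icc (0 : ℝ) 1) (htpos : 0 < t) (hmin : ∀ s ∈ Icc (0 : ℝ) 1, s ∈ T x → t ≤ s)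
    (ht' : t' ∈ Icc (0 : ℝ) 1) (hmin' : ∀ s ∈ Icc (0 : ℝ) 1, s ∈ T x' → t' ≤ s)
    (hcross : t ∈ T x') (hcross' : t' ∈ T x) : False := by
  have h1 : t' ≤ t := hmin' t ht hcross
  have h2' : t ≤ t' := hmin t' ht' hcross'
  have heq : t' = t := le_antisymm h1 h2'
  obtain ⟨w, hw, htw⟩ := exists_mem_of_Ico_covered T hT {x, x'} htpos fun s hs0 hst => by
    have hs1 : s ∈ Icc (0 : ℝ) 1 := ⟨hs0, hst.le.trans ht.2⟩
    obtain ⟨y, hsy⟩ := hcov s hs1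
    refine ⟨y, fun hy => ?_, hsy⟩
    rw [Finset.mem_insert, Finset.mem_singleton] at hy
    rcases hy with rfl | rfl
    · exact absurd (hmin s hs1 hsy) (not_le.2 hst)
    · exact absurd (hmin' s hs1 hsy) (not_le.2 (heq ▸ hst))
  rw [Finset.mem_insert, Finset.mem_singleton, not_or] at hw
  rcases h2 t ht x x' w (heq ▸ hcross') hcross htw with h | h | h
  · exact hxx' h
  · exact hw.2 h.symm
  · exact hw.1 h.symm

end Sweep

/-! ### Weak tops, sharp tops, and the normal cone at a vertex of a strictly convex ccw polygon -/

section Cones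

variable {q : ℕ}

/-- `x` is a WEAK TOP of the curve `P : ℤ/q → ℝ²` at the weight `θ`: `⟨θ, P x'⟩ ≤ ⟨θ, P x⟩` for every label `x'`. -/
def WTop (P : ZMod q → (Fin 2 → ℝ)) (θ : Fin 2 → ℝ) (x : ZMod q) : Prop := ∀ x' : ZMod q, θ ⬝ᵥ P x' ≤ θ ⬝ᵥ P x

/-- SHARP TOPS: at every non-zero weight the curve has at most two weak tops, and two weak tops are label-adjacent
(the property of a strictly convex polygon listed along its boundary). -/
def SharpTops (P : ZMod q → (Fin 2 → ℝ)) : Prop :=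
  ∀ θ : Fin 2 → ℝ, θ ≠ 0 →
    (∀ x y : ZMod q, WTop P θ x → WTop P θ y → y = x ∨ y = x + 1 ∨ x = y + 1) ∧
    (∀ x y w : ZMod q, WTop P θ x → WTop P θ y → WTop P θ w → x = y ∨ y = w ∨ x = w)

/-- The quarter-turn `perp v = (v₁, −v₀)` (for a counter-clockwise polygon, `perp` of an edge vector is its OUTWARD normal). -/
def perp (v : Fin 2 → ℝ) : Fin 2 → ℝ := ![v 1, -v 0]

/-- Every weight has a weak top (finite maximum). [folklore] -/
theorem exists_wTop [NeZero q] (P : ZMod q → (Fin 2 → ℝ)) (θ : Fin 2 → ℝ) : ∃ x, WTop P θ x := by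
  obtain ⟨x, -, hx⟩ := Finset.exists_max_image Finset.univ (fun x => θ ⬝ᵥ P x) Finset.univ_nonempty
  exact ⟨x, fun x' => hx x' (Finset.mem_univ _)⟩

/-- Positive rescaling of the weight does not change weak tops. [folklore] -/
theorem wTop_smul_iff (P : ZMod q → (Fin 2 → ℝ)) {θ : Fin 2 → ℝ} {r : ℝ} (hr : 0 < r) (x : ZMod q) :
    WTop P (r • θ) x ↔ WTop P θ x := by
  simp only [WTop, smul_dotProduct, smul_eq_mul]
  exact ⟨fun h x' => le_of_mul_le_mul_left (h x') hr, fun h x' => mul_le_mul_of_nonneg_left (h x') hr.le⟩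

/-- `⟨perp u, v⟩ = det(v, u)`. [folklore] -/
theorem perp_dotProduct (u v : Fin 2 → ℝ) : perp u ⬝ᵥ v = cross2 v u := by
  rw [dotProduct_fin_two, perp, cross2]
  simp only [Matrix.cons_val_zero, Matrix.cons_val_one]
  ring

/-- `⟨perp u, u⟩ = 0`. [folklore] -/
theorem perp_dotProduct_self (u : Fin 2 → ℝ) : perp u ⬝ᵥ u = 0 := by
  rw [perp_dotProduct, cross2_self]

/-- Plane identity: `det(d₁,d₂)·θ = (−⟨θ,d₂⟩)·perp d₁ + ⟨θ,d₁⟩·perp d₂` (coordinates of a weight in the basis of the two normals). [folklore] -/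
theorem cross2_smul_eq (d₁ d₂ θ : Fin 2 → ℝ) :
    cross2 d₁ d₂ • θ = (-(θ ⬝ᵥ d₂)) • perp d₁ + (θ ⬝ᵥ d₁) • perp d₂ := by
  ext i
  fin_cases i <;> simp [perp, cross2, Matrix.cons_val_zero, Matrix.cons_val_one] <;> ring

/-- The left turn at the vertex `z` of a strictly convex ccw polygon: `det(Δ(z−1), Δ z) > 0` (`q ≥ 3`). [folklore] -/
theorem cross2_edgeVec_pos {c : ZMod q → (Fin 2 → ℝ)} (hc : StrictlyConvexCcw c) (hq : 3 ≤ q) (z : ZMod q) :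
    0 < cross2 (edgeVec c (z - 1)) (edgeVec c z) := by
  have h2ne : (2 : ZMod q) ≠ 0 := two_ne_zero_of_three_le hq
  have h1ne : (1 : ZMod q) ≠ 0 := one_ne_zero_of_three_le hq
  have h := hc (z - 1) (z + 1) (fun h => h2ne (by linear_combination h)) (fun h => h1ne (by linear_combination h))
  rw [sub_add_cancel] at h
  have : cross2 (c z - c (z - 1)) (c (z + 1) - c (z - 1)) = cross2 (edgeVec c (z - 1)) (edgeVec c z) := by
    simp only [edgeVec, sub_add_cancel, cross2, Pi.sub_apply]; ring
  rwa [this] at h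

/-- **Local form of the normal cone.**  For a strictly convex ccw polygon (`q ≥ 3`) and a non-zero weight `θ`, the vertex `z` is a weak
top iff `⟨θ, Δ(z−1)⟩ ≥ 0 ≥ ⟨θ, Δ z⟩`. [folklore] -/
theorem wTop_iff_local {c : ZMod q → (Fin 2 → ℝ)} (hc : StrictlyConvexCcw c) (hq : 3 ≤ q) {θ : Fin 2 → ℝ} (hθ : θ ≠ 0)
    (z : ZMod q) : WTop c θ z ↔ 0 ≤ θ ⬝ᵥ edgeVec c (z - 1) ∧ θ ⬝ᵥ edgeVec c z ≤ 0 := by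
  constructor
  · intro h
    refine ⟨?_, ?_⟩
    · have := h (z - 1)
      rw [edgeVec, sub_add_cancel, dotProduct_sub]; linarith
    · have := h (z + 1)
      rw [edgeVec, dotProduct_sub]; linarith
  · rintro ⟨h1, h2⟩ x
    have hl : θ ⬝ᵥ c (z - 1) ≤ θ ⬝ᵥ c z := by
      rw [edgeVec, sub_add_cancel, dotProduct_sub] at h1; linarith
    have hr : θ ⬝ᵥ c (z + 1) ≤ θ ⬝ᵥ c z := by
      rw [edgeVec, dotProduct_sub] at h2; linarith
    by_cases hx0 : x = z - 1
    · rw [hx0]; exact hl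
    by_cases hx1 : x = z
    · rw [hx1]
    by_cases hx2 : x = z + 1
    · rw [hx2]; exact hr
    exact (isLocalMax_lt hc hq hθ hl hr hx0 hx1 hx2).le

/-- The CONE PATH between the two incident normals of the vertex `z`: `t ↦ (1 − t)·perp Δ(z−1) + t·perp Δ z`. -/
def conePath (c : ZMod q → (Fin 2 → ℝ)) (z : ZMod q) (t : ℝ) : Fin 2 → ℝ :=
  (1 - t) • perp (edgeVec c (z - 1)) + t • perp (edgeVec c z)

/-- A functional along the cone path is affine in the time. [folklore] -/
theorem conePath_dotProduct (c : ZMod q → (Fin 2 → ℝ)) (z : ZMod q) (t : ℝ) (v : Fin 2 → ℝ) :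
    conePath c z t ⬝ᵥ v = (1 - t) * (perp (edgeVec c (z - 1)) ⬝ᵥ v) + t * (perp (edgeVec c z) ⬝ᵥ v) := by
  rw [conePath, add_dotProduct, smul_dotProduct, smul_dotProduct, smul_eq_mul, smul_eq_mul]

/-- The cone path never vanishes (the two normals are independent). [folklore] -/
theorem conePath_ne_zero {c : ZMod q → (Fin 2 → ℝ)} (hc : StrictlyConvexCcw c) (hq : 3 ≤ q) (z : ZMod q) (t : ℝ) :
    conePath c z t ≠ 0 := by
  intro h0
  have hΔ := cross2_edgeVec_pos hc hq z
  have e1 := congrArg (fun w => w ⬝ᵥ edgeVec c (z - 1)) h0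
  have e2 := congrArg (fun w => w ⬝ᵥ edgeVec c z) h0
  simp only [conePath_dotProduct, perp_dotProduct_self, perp_dotProduct, zero_dotProduct, mul_zero, zero_add,
    add_zero] at e1 e2
  rw [cross2_swap] at e2
  have ht : t = 0 := by
    rcases mul_eq_zero.1 e1 with h | h
    · exact h
    · exact absurd h hΔ.ne'
  rw [ht] at e2
  norm_num at e2
  exact hΔ.ne' e2

/-- Every point of the cone path (`t ∈ [0,1]`) is a weak-top weight of the vertex `z`. [folklore] -/
theorem wTop_conePath {c : ZMod q → (Fin 2 → ℝ)} (hc : StrictlyConvexCcw c) (hq : 3 ≤ q) (z : ZMod q) {t : ℝ}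
    (ht : t ∈ Icc (0 : ℝ) 1) : WTop c (conePath c z t) z := by
  have hΔ := cross2_edgeVec_pos hc hq z
  rw [wTop_iff_local hc hq (conePath_ne_zero hc hq z t)]
  refine ⟨?_, ?_⟩
  · rw [conePath_dotProduct, perp_dotProduct_self, perp_dotProduct, mul_zero, zero_add]
    exact mul_nonneg ht.1 hΔ.le
  · rw [conePath_dotProduct, perp_dotProduct_self, perp_dotProduct, mul_zero, add_zero, cross2_swap]
    nlinarith [ht.2]

/-- **The normal cone is swept by the cone path**: every non-zero weak-top weight of the vertex `z` is a positive multiple of a point of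
the path. [folklore] -/
theorem exists_conePath_of_wTop {c : ZMod q → (Fin 2 → ℝ)} (hc : StrictlyConvexCcw c) (hq : 3 ≤ q) (z : ZMod q)
    {θ : Fin 2 → ℝ} (hθ : θ ≠ 0) (h : WTop c θ z) :
    ∃ t ∈ Icc (0 : ℝ) 1, ∃ r : ℝ, 0 < r ∧ θ = r • conePath c z t := by
  have hΔ := cross2_edgeVec_pos hc hq z
  obtain ⟨h1, h2⟩ := (wTop_iff_local hc hq hθ z).1 h
  set s : ℝ := -(θ ⬝ᵥ edgeVec c z) with hs
  set s' : ℝ := θ ⬝ᵥ edgeVec c (z - 1) with hs'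
  have hs0 : 0 ≤ s := by rw [hs]; linarith
  have hs'0 : 0 ≤ s' := h1
  have key := cross2_smul_eq (edgeVec c (z - 1)) (edgeVec c z) θ
  rw [← hs, ← hs'] at key
  have hsum : 0 < s + s' := by
    rcases lt_or_eq_of_le (add_nonneg hs0 hs'0) with hlt | heq
    · exact hlt
    · exfalso
      have hs1 : s = 0 := by linarith
      have hs2 : s' = 0 := by linarith
      rw [hs1, hs2, zero_smul, zero_smul, add_zero] at key
      exact hθ ((smul_eq_zero.1 key).resolve_left hΔ.ne')
  refine ⟨s' / (s + s'), ⟨div_nonneg hs'0 hsum.le, (div_le_one hsum).2 (by linarith)⟩, (s + s') / cross2 (edgeVec c (z - 1)) (edgeVec c z),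
    div_pos hsum hΔ, ?_⟩
  have h1' : 1 - s' / (s + s') = s / (s + s') := by field_simp; ring
  rw [conePath, h1']
  have : θ = (1 / cross2 (edgeVec c (z - 1)) (edgeVec c z)) • (s • perp (edgeVec c (z - 1)) + s' • perp (edgeVec c z)) := by
    rw [← key, smul_smul, one_div_mul_cancel hΔ.ne', one_smul]
  rw [this, smul_add, smul_add, smul_smul, smul_smul, smul_smul, smul_smul]
  congr 1 <;> congr 1 <;> field_simp

/-- **Strictly convex polygons have sharp tops** (`q ≥ 3`): two weak tops at a non-zero weight are label-adjacent, and there are never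
three (the weight would be orthogonal to two independent edge vectors). [folklore] -/
theorem sharpTops_of_strictlyConvexCcw {c : ZMod q → (Fin 2 → ℝ)} (hc : StrictlyConvexCcw c) (hq : 3 ≤ q) : SharpTops c := by
  intro θ hθ
  have hadj : ∀ x y : ZMod q, WTop c θ x → WTop c θ y → y = x ∨ y = x + 1 ∨ x = y + 1 := by
    intro x y hx hy
    by_contra hne
    push Not at hne
    have hy0 : y ≠ x - 1 := fun h => hne.2.2 (by rw [h, sub_add_cancel])
    have hlt := isLocalMax_lt hc hq hθ (hx (x - 1)) (hx (x + 1)) hy0 hne.1 hne.2.1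
    exact absurd (hy x) (not_le.2 hlt)
  refine ⟨hadj, fun x y w hx hy hw => ?_⟩
  by_contra hne
  push Not at hne
  -- the three tops are `x - 1, x, x + 1` in some order: all three values are equal
  have hval : ∀ u v : ZMod q, WTop c θ u → WTop c θ v → θ ⬝ᵥ c u = θ ⬝ᵥ c v := fun u v hu hv => le_antisymm (hv u) (hu v)
  -- among three pairwise adjacent distinct labels one is the middle: find `m` with `m - 1`, `m + 1` the other two
  have hmid : ∃ m : ZMod q, WTop c θ m ∧ WTop c θ (m - 1) ∧ WTop c θ (m + 1) := by
    rcases hadj x y hx hy with h | h | h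
    · exact absurd h.symm hne.1
    · -- y = x + 1
      rcases hadj x w hx hw with h' | h' | h'
      · exact absurd h'.symm hne.2.2
      · exact absurd (h.trans h'.symm) hne.2.1
      · -- w = x - 1
        refine ⟨x, hx, ?_, h ▸ hy⟩
        rw [h', add_sub_cancel_right]; exact hw
    · -- x = y + 1
      rcases hadj x w hx hw with h' | h' | h'
      · exact absurd h'.symm hne.2.2
      · refine ⟨x, hx, ?_, h' ▸ hw⟩
        rw [h, add_sub_cancel_right]; exact hy
      · -- x = w + 1 and x = y + 1 ⇒ y = w
        exact absurd (add_right_cancel (h.symm.trans h')) hne.2.1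
  obtain ⟨m, hm, hm1, hm2⟩ := hmid
  have e1 : θ ⬝ᵥ edgeVec c (m - 1) = 0 := by
    rw [edgeVec, sub_add_cancel, dotProduct_sub, hval _ _ hm hm1, sub_self]
  have e2 : θ ⬝ᵥ edgeVec c m = 0 := by
    rw [edgeVec, dotProduct_sub, hval _ _ hm2 hm, sub_self]
  exact hθ (eq_zero_of_dotProduct_eq_zero (cross2_edgeVec_pos hc hq m).ne' e1 e2)

end Cones


end TotalsLaw

end Summit.ValiantsHypothesis.ValiantsHypothesis.Theorems.NewtonUnitEquationsDissociatedUniform
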